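import Summits.ValiantsHypothesis.ValiantsHypothesis.Theorems.KPlusLogSqLawTropicalBGaugeSymmetry

/-!
# Route `KPlusLogSqLaw`, crux `TropicalB` — the WRAP INDICATOR is a gauge term: wrap-affine circulant designs

HONEST FRAMING.  Helper toward the registered stubs `stub_tropThin` / `stub_tropFat` of
`Cruxes/TropicalB/Lines/birth.lean` (crux `Summit.ValiantsHypothesis.ValiantsHypothesis.Theses.KPlusLogSqLaw.TropicalB`,
ledger item `stmt-ValiantsHypothesis-19771`, route `KPlusLogSqLaw`; cell `pub-symmetroid`, seat `val-sym-trop-p3`,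
2026-08-26).  A corollary of this seat's `…TropicalBGaugeSymmetry`; located step for the cell's Conjecture T discussion
(desk R1388 (b)).  Nothing here bounds `TropicalB` for general designs, and nothing bears on `KPlusLogSqLaw`,
`MatrixDescartes` or `VP ≠ VNP`.

THE IDENTITY.  On `Fin (n+1)` with `ρ = finRotate (n+1)` (`a ↦ a + 1`), the wrap indicator `[a < b]` changes under the
simultaneous shift by a ROW term minus a COLUMN term:
`[ρ a < ρ b] − [a < b] = [a = last] − [b = last]` (`wrap_shift_eq`).  Hence a design whose valuations are a cyclic-difference
core plus a multiple of the wrap indicator, `v a b l = V (a − b) l + E·[a < b]` (subtraction in `Fin (n+1)`), with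
circulant presence `ε a b l = P (a − b) l`, is GAUGE-circulant, and `gaugeCirculant_chain_succ_le` gives
`wrapAffine_chain_succ_le : N + 1 ≤ (n+1)·K` — at most `m·K` dominant terms, «m-phase».  Located boundary: SHIFT-THREE's
presence pattern depends on the wrap bit (class 2 on wrapping entries only) and its class-1 price on the column — both
outside this class. [folklore]
-/

set_option linter.dupNamespace false
set_option autoImplicit false

namespace Summit.ValiantsHypothesis.ValiantsHypothesis.Theorems.KPlusLogSqLaw

open Summit.ValiantsHypothesis.ValiantsHypothesis.Theorems.MatrixDescartes.Negative
open Summit.ValiantsHypothesis.ValiantsHypothesis.Theorems.LacunarySymmetroidMatrixDescartes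
open Summit.ValiantsHypothesis.ValiantsHypothesis.Theorems.LacunarySymmetroidMatrixDescartes.TropicalCensus
open scoped BigOperators
open Finset

section WrapGauge

variable {n K : ℕ}

/-- **The wrap indicator is a gauge term**: `[a+1 < b+1] − [a < b] = [a = last] − [b = last]` on `Fin (n+1)`
(cyclic successor). [folklore] -/
theorem wrap_shift_eq (a b : Fin (n + 1)) :
    ((if (finRotate (n + 1)) a < (finRotate (n + 1)) b then (1 : ℤ) else 0) - (if a < b then 1 else 0)) =
      (if a = Fin.last n then (1 : ℤ) else 0) - (if b = Fin.last n then 1 else 0) := by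
  have ha := a.isLt; have hb := b.isLt
  have hra : ((finRotate (n + 1) a : Fin (n + 1)) : ℕ) = if (a : ℕ) = n then 0 else (a : ℕ) + 1 := by
    rw [finRotate_apply]
    by_cases h : a = Fin.last n
    · subst h; simp [Fin.val_last]
    · rw [Fin.val_add_one_of_lt (lt_of_le_of_ne (Fin.le_last a) h)]
      have : (a : ℕ) ≠ n := fun h' => h (Fin.ext (by rw [h', Fin.val_last]))
      simp [this]
  have hrb : ((finRotate (n + 1) b : Fin (n + 1)) : ℕ) = if (b : ℕ) = n then 0 else (b : ℕ) + 1 := by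
    rw [finRotate_apply]
    by_cases h : b = Fin.last n
    · subst h; simp [Fin.val_last]
    · rw [Fin.val_add_one_of_lt (lt_of_le_of_ne (Fin.le_last b) h)]
      have : (b : ℕ) ≠ n := fun h' => h (Fin.ext (by rw [h', Fin.val_last]))
      simp [this]
  have e1 : ((finRotate (n + 1)) a < (finRotate (n + 1)) b) ↔
      ((if (a : ℕ) = n then 0 else (a : ℕ) + 1) < (if (b : ℕ) = n then 0 else (b : ℕ) + 1)) := by
    rw [Fin.lt_def, hra, hrb]
  have e2 : (a = Fin.last n) ↔ (a : ℕ) = n := by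
    constructor
    · intro h; rw [h, Fin.val_last]
    · intro h; exact Fin.ext (by rw [h, Fin.val_last])
  have e3 : (b = Fin.last n) ↔ (b : ℕ) = n := by
    constructor
    · intro h; rw [h, Fin.val_last]
    · intro h; exact Fin.ext (by rw [h, Fin.val_last])
  simp only [e1, e2, e3, Fin.lt_def]
  by_cases hA : (a : ℕ) = n <;> by_cases hB : (b : ℕ) = n <;> simp [hA, hB] <;> omega

/-- **Wrap-affine circulant designs have at most `m·K` dominant terms.**  If `v a b l = V (a − b) l + E·[a < b]` and
`ε a b l = P (a − b) l` on `Fin (n+1)` (cyclic difference), every sign-alternating dominant chain has `N + 1 ≤ (n+1)·K`: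
the design is gauge-circulant (`wrap_shift_eq`) and `gaugeCirculant_chain_succ_le` applies. [folklore] -/
theorem wrapAffine_chain_succ_le (d : Fin K → ℕ) (v ε : Fin (n + 1) → Fin (n + 1) → Fin K → ℤ)
    (V P : Fin (n + 1) → Fin K → ℤ) (E : ℤ)
    (hv : ∀ a b l, v a b l = V (a - b) l + E * (if a < b then 1 else 0))
    (hε : ∀ a b l, ε a b l = P (a - b) l)
    {N : ℕ} (θ : Fin (N + 1) → ℤ) (p : Fin (N + 1) → Equiv.Perm (Fin (n + 1)) × (Fin (n + 1) → Fin K))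
    (hθ : StrictMono θ) (hdom : ∀ k, IsDominant d v ε (θ k) (p k))
    (halt : ∀ k : Fin N, termSign ε (p k.castSucc) * termSign ε (p k.succ) < 0) :
    N + 1 ≤ (n + 1) * K := by
  have hdiff : ∀ a b : Fin (n + 1), (finRotate (n + 1)) a - (finRotate (n + 1)) b = a - b := by
    intro a b; rw [finRotate_apply, finRotate_apply, add_sub_add_right_eq_sub]
  refine gaugeCirculant_chain_succ_le (m := n + 1) (Nat.succ_pos n) d v ε
    (fun a => E * (if a = Fin.last n then 1 else 0)) (fun b => -(E * (if b = Fin.last n then 1 else 0)))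
    (fun a b l => ?_) (fun a b l => by rw [hε, hε, hdiff]) θ p hθ hdom halt
  rw [hv, hv, hdiff]
  have h := wrap_shift_eq a b
  have : E * (if (finRotate (n + 1)) a < (finRotate (n + 1)) b then (1 : ℤ) else 0) =
      E * (if a < b then 1 else 0) + E * (if a = Fin.last n then 1 else 0) - E * (if b = Fin.last n then 1 else 0) := by
    have := congrArg (fun x => E * x) h
    simp only [mul_sub] at this
    linarith
  linarith

end WrapGauge

end Summit.ValiantsHypothesis.ValiantsHypothesis.Theorems.KPlusLogSqLaw
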